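import Literature.Probability.Percolation.TriLatticeCells
import HarnessLib

/-!
# Sharp distances in the triangular lattice: a lattice point is far from non-incident edges and cells

Topic `Literature/Probability/Percolation`; family `crit-perc`. Elementary metric facts about the
equilateral embedding of `𝕋` in the lattice coordinates `triX`, `triY` of `TriLatticeSegments.lean`,
for the tethers of the discrete approximations of a Jordan domain (Bollobás–Riordan, *Percolation*
(2006), Ch. 7, Lemma 14: the last leg of a tether, of length `≤ 0.7` about a site off the domain,
must miss the cells and edges of the domain):

* `abs_lform_sub_le` — **the three lattice forms are `2/√3`-Lipschitz**:
  `|F_i(z) - F_i(w)| ≤ (2/√3) ‖z - w‖` (sharpening `abs_triX_sub_le`, whose constant is `2`);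
  hence a unit gap in a form forces distance `≥ √3/2` (`sqrt_three_div_two_le_norm_of_one_le`).
* `sqrt_three_div_two_le_dist_of_mem_triCell` — **a point of a cell is at distance `≥ √3/2` from
  every lattice point which is not a vertex of the cell** (one of the three forms differs by `≥ 1`).
* `sqrt_three_div_two_le_dist_of_mem_unitEdge` — **a point of a closed unit edge is at distance
  `≥ √3/2` from every lattice point other than its endpoints** (off the edge's lattice line the type
  form differs by `≥ 1`; on it, the varying form does).

## References

* B. Bollobás, O. Riordan, *Percolation*, Cambridge University Press (2006), Ch. 7 §7.2.5.

## Mathlib / tree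

Tree: `TriLatticeSegments.lean` (`triX`, `triY`, `lform`, `ltype`, `ldelta`,
`exists_param_of_mem_unitEdge`, `lform_triEmbed`, `eq_of_lform_eq`), `TriLatticeCells.lean`
(`triCell`, `coords_of_mem_triCell`, `cellForm`), `TriangularLattice(Proofs).lean`
(`mem_hexFaceVertices_zero/one`).
-/

noncomputable section

open Complex Set Metric Literature.Probability.LatticeModels

namespace Literature.Probability.Percolation

/-! ### The forms are `2/√3`-Lipschitz -/

/-- `(u - v/√3)² ≤ (4/3)(u² + v²)` and the like: the quadratic inequality behind the Lipschitz
bounds. [folklore] -/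
theorem sq_sub_div_sqrt_three_le (u v : ℝ) : (u - v / Real.sqrt 3) ^ 2 ≤ 4 / 3 * (u ^ 2 + v ^ 2) := by
  have h3 : Real.sqrt 3 ^ 2 = 3 := Real.sq_sqrt (by norm_num)
  have h3' : 0 < Real.sqrt 3 := Real.sqrt_pos.2 (by norm_num)
  rw [div_eq_mul_inv]
  have hi : (Real.sqrt 3)⁻¹ ^ 2 = 1 / 3 := by rw [inv_pow, h3]; norm_num
  nlinarith [sq_nonneg (u / 3 + v * (Real.sqrt 3)⁻¹), hi, sq_nonneg (u * (Real.sqrt 3)⁻¹ * 3 + v),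
    mul_pos h3' h3', sq_nonneg ((Real.sqrt 3)⁻¹), h3]

/-- **`triX` is `2/√3`-Lipschitz.** [folklore] -/
theorem abs_triX_sub_le' (z w : ℂ) : |triX z - triX w| ≤ 2 / Real.sqrt 3 * ‖z - w‖ := by
  have h3' : 0 < Real.sqrt 3 := Real.sqrt_pos.2 (by norm_num)
  have h3 : Real.sqrt 3 ^ 2 = 3 := Real.sq_sqrt (by norm_num)
  rw [← triX_sub]
  set d := z - w
  have hX : triX d = d.re - d.im / Real.sqrt 3 := rfl
  have hsq : (triX d) ^ 2 ≤ (2 / Real.sqrt 3 * ‖d‖) ^ 2 := by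
    rw [hX, mul_pow, div_pow, h3, Complex.sq_norm, Complex.normSq_apply]
    have := sq_sub_div_sqrt_three_le d.re d.im
    nlinarith
  have hnn : 0 ≤ 2 / Real.sqrt 3 * ‖d‖ := by positivity
  exact abs_le_of_sq_le_sq' hsq hnn |> fun h => abs_le.2 h

/-- **`triY` is `2/√3`-Lipschitz.** [folklore] -/
theorem abs_triY_sub_le' (z w : ℂ) : |triY z - triY w| ≤ 2 / Real.sqrt 3 * ‖z - w‖ := by
  have h3' : 0 < Real.sqrt 3 := Real.sqrt_pos.2 (by norm_num)
  rw [← triY_sub]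
  set d := z - w
  have hY : triY d = d.im * 2 / Real.sqrt 3 := rfl
  have h1 : |d.im| ≤ ‖d‖ := Complex.abs_im_le_norm d
  rw [hY, abs_div, abs_mul, abs_of_pos h3', abs_of_pos (by norm_num : (0 : ℝ) < 2)]
  rw [div_le_iff₀ h3']
  have : 2 / Real.sqrt 3 * ‖d‖ * Real.sqrt 3 = 2 * ‖d‖ := by field_simp
  rw [this]; linarith

/-- **`triX + triY` is `2/√3`-Lipschitz.** [folklore] -/
theorem abs_triX_add_triY_sub_le (z w : ℂ) : |(triX z + triY z) - (triX w + triY w)| ≤ 2 / Real.sqrt 3 * ‖z - w‖ := by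
  have h3' : 0 < Real.sqrt 3 := Real.sqrt_pos.2 (by norm_num)
  have h3 : Real.sqrt 3 ^ 2 = 3 := Real.sq_sqrt (by norm_num)
  have e : (triX z + triY z) - (triX w + triY w) = triX (z - w) + triY (z - w) := by rw [triX_sub, triY_sub]; ring
  rw [e]
  set d := z - w
  have hXY : triX d + triY d = d.re + d.im / Real.sqrt 3 := by
    simp only [triX, triY]; field_simp; ring
  have hsq : (triX d + triY d) ^ 2 ≤ (2 / Real.sqrt 3 * ‖d‖) ^ 2 := by
    rw [hXY, mul_pow, div_pow, h3, Complex.sq_norm, Complex.normSq_apply]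
    have := sq_sub_div_sqrt_three_le d.re (-d.im)
    have e2 : d.re - -d.im / Real.sqrt 3 = d.re + d.im / Real.sqrt 3 := by ring
    rw [e2] at this
    nlinarith
  have hnn : 0 ≤ 2 / Real.sqrt 3 * ‖d‖ := by positivity
  exact abs_le.2 (abs_le_of_sq_le_sq' hsq hnn)

/-- **All three lattice forms are `2/√3`-Lipschitz.** [folklore] -/
theorem abs_lform_sub_le (i : Fin 3) (z w : ℂ) : |lform i z - lform i w| ≤ 2 / Real.sqrt 3 * ‖z - w‖ := by
  fin_cases i
  · exact abs_triX_sub_le' z w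
  · exact abs_triY_sub_le' z w
  · exact abs_triX_add_triY_sub_le z w

/-- **A unit gap in a lattice form forces distance `≥ √3/2`.** [folklore] -/
theorem sqrt_three_div_two_le_norm_of_one_le {i : Fin 3} {z w : ℂ} (h : 1 ≤ |lform i z - lform i w|) :
    Real.sqrt 3 / 2 ≤ ‖z - w‖ := by
  have h3' : 0 < Real.sqrt 3 := Real.sqrt_pos.2 (by norm_num)
  have h1 := abs_lform_sub_le i z w
  have h2 : 1 ≤ 2 / Real.sqrt 3 * ‖z - w‖ := h.trans h1
  rw [div_mul_eq_mul_div, le_div_iff₀ h3'] at h2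
  linarith

/-! ### A lattice point is far from the cells not having it as a vertex -/

/-- The three forms of a point of a cell lie in the cell's unit windows, with the third form on the
correct side of the cell's diagonal. [folklore] -/
theorem forms_of_mem_triCell {F : HexVertex} {z : ℂ} (hz : z ∈ triCell F) :
    (F.1 0 : ℝ) ≤ triX z ∧ triX z ≤ F.1 0 + 1 ∧ (F.1 1 : ℝ) ≤ triY z ∧ triY z ≤ F.1 1 + 1 ∧
      (F.2 = 0 → triX z + triY z ≤ F.1 0 + F.1 1 + 1) ∧ (F.2 = 1 → (F.1 0 : ℝ) + F.1 1 + 1 ≤ triX z + triY z) := by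
  obtain ⟨a, b, c, d⟩ := coords_of_mem_triCell hz
  refine ⟨a, b, c, d, fun h0 => ?_, fun h1 => ?_⟩
  · have := hz 0
    rcases F with ⟨x, t⟩
    simp only at h0; subst h0
    simp only [cellForm, Fin.isValue, ↓reduceIte, Matrix.cons_val_zero] at this
    linarith
  · have := hz 1
    rcases F with ⟨x, t⟩
    simp only at h1; subst h1
    simp only [cellForm, Fin.isValue, one_ne_zero, ↓reduceIte, Matrix.cons_val_one, Matrix.cons_val_zero] at this
    linarith

/-- **A point of a cell is at distance `≥ √3/2` from every lattice point which is not a vertex of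
the cell**: comparing the lattice coordinates of the point (in the cell's unit windows) with the
integer coordinates of the site, one of the three forms differs by at least `1` unless the site is
one of the three vertices. [folklore] -/
theorem sqrt_three_div_two_le_dist_of_mem_triCell {F : HexVertex} {z : ℂ} (hz : z ∈ triCell F) {a : Site 2}
    (ha : a ∉ hexFaceVertices F) : Real.sqrt 3 / 2 ≤ dist z (triEmbed a) := by
  rw [dist_eq_norm]
  obtain ⟨h1, h2, h3, h4, hup, hdown⟩ := forms_of_mem_triCell hz
  have hXa : lform 0 (triEmbed a) = a 0 := by rw [lform_triEmbed]; simp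
  have hYa : lform 1 (triEmbed a) = a 1 := by rw [lform_triEmbed]; simp
  have hXYa : lform 2 (triEmbed a) = a 0 + a 1 := by rw [lform_triEmbed]; simp
  -- reduce to: some form differs by `≥ 1`
  suffices key : ∃ i : Fin 3, 1 ≤ |lform i z - lform i (triEmbed a)| by
    obtain ⟨i, hi⟩ := key; exact sqrt_three_div_two_le_norm_of_one_le hi
  rcases F with ⟨x, t⟩
  simp only at h1 h2 h3 h4 hup hdown
  by_cases hx0 : a 0 + 1 ≤ x 0
  · refine ⟨0, ?_⟩; rw [lform_zero, hXa]
    have : (a 0 : ℝ) + 1 ≤ x 0 := by exact_mod_cast hx0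
    rw [le_abs]; left; linarith
  by_cases hx2 : x 0 + 2 ≤ a 0
  · refine ⟨0, ?_⟩; rw [lform_zero, hXa]
    have : (x 0 : ℝ) + 2 ≤ a 0 := by exact_mod_cast hx2
    rw [le_abs]; right; linarith
  by_cases hy0 : a 1 + 1 ≤ x 1
  · refine ⟨1, ?_⟩; rw [lform_one, hYa]
    have : (a 1 : ℝ) + 1 ≤ x 1 := by exact_mod_cast hy0
    rw [le_abs]; left; linarith
  by_cases hy2 : x 1 + 2 ≤ a 1
  · refine ⟨1, ?_⟩; rw [lform_one, hYa]
    have : (x 1 : ℝ) + 2 ≤ a 1 := by exact_mod_cast hy2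
    rw [le_abs]; right; linarith
  -- now `a 0 ∈ {x 0, x 0 + 1}` and `a 1 ∈ {x 1, x 1 + 1}`
  have ha0 : a 0 = x 0 ∨ a 0 = x 0 + 1 := by omega
  have ha1 : a 1 = x 1 ∨ a 1 = x 1 + 1 := by omega
  have hav : a = ![a 0, a 1] := by ext i; fin_cases i <;> rfl
  rcases HexVertex.snd_eq_zero_or_one (x, t) with ht | ht <;> simp only at ht <;> subst ht
  · -- up cell: vertices `x`, `x + e₀`, `x + e₁`; the remaining candidate is `x + e₀ + e₁`
    have hsum := hup rfl
    rcases ha0 with h0 | h0 <;> rcases ha1 with h1' | h1'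
    · exact absurd (by rw [mem_hexFaceVertices_zero]; left; ext i; fin_cases i <;> simp [h0, h1']) ha
    · exact absurd (by
        rw [mem_hexFaceVertices_zero]; right; right; ext i; fin_cases i <;> simp [h0, h1']) ha
    · exact absurd (by
        rw [mem_hexFaceVertices_zero]; right; left; ext i; fin_cases i <;> simp [h0, h1']) ha
    · refine ⟨2, ?_⟩; rw [lform_two, hXYa]
      have : (a 0 : ℝ) + a 1 = x 0 + x 1 + 2 := by rw [h0, h1']; push_cast; ring
      rw [this, le_abs]; right; linarith
  · -- down cell: vertices `x + e₀`, `x + e₀ + e₁`, `x + e₁`; the remaining candidate is `x`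
    have hsum := hdown rfl
    rcases ha0 with h0 | h0 <;> rcases ha1 with h1' | h1'
    · refine ⟨2, ?_⟩; rw [lform_two, hXYa]
      have : (a 0 : ℝ) + a 1 = x 0 + x 1 := by rw [h0, h1']
      rw [this, le_abs]; left; linarith
    · exact absurd (by
        rw [mem_hexFaceVertices_one]; right; left; ext i; fin_cases i <;> simp [h0, h1']) ha
    · exact absurd (by
        rw [mem_hexFaceVertices_one]; left; ext i; fin_cases i <;> simp [h0, h1']) ha
    · exact absurd (by
        rw [mem_hexFaceVertices_one]; right; right; ext i; fin_cases i <;> simp [h0, h1']) ha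

/-! ### A lattice point is far from the unit edges not ending at it -/

/-- **A point of a closed unit edge is at distance `≥ √3/2` from every lattice point other than the
two endpoints.** Along the edge the type form is the integer `F(b)`; if `F(a) ≠ F(b)` the type form
differs by `≥ 1`; otherwise a form varying along the edge runs through `[n, n + 1]` (or
`[n - 1, n]`) while `a`, not an endpoint, has an integer value outside. [folklore] -/
theorem sqrt_three_div_two_le_dist_of_mem_unitEdge {b : Site 2} {k : Fin 6} {q : ℂ}
    (hq : q ∈ segment ℝ (triEmbed b) (triEmbed (b + triDir k))) {a : Site 2} (ha : a ≠ b) (ha' : a ≠ b + triDir k) :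
    Real.sqrt 3 / 2 ≤ dist q (triEmbed a) := by
  rw [dist_eq_norm]
  obtain ⟨θ, h0, h1, hθ⟩ := exists_param_of_mem_unitEdge hq
  -- integer values of the forms at lattice points
  have hint : ∀ (i : Fin 3) (v : Site 2), ∃ n : ℤ, lform i (triEmbed v) = n := fun i v =>
    ⟨![v 0, v 1, v 0 + v 1] i, lform_triEmbed i v⟩
  suffices key : ∃ i : Fin 3, 1 ≤ |lform i q - lform i (triEmbed a)| by
    obtain ⟨i, hi⟩ := key; exact sqrt_three_div_two_le_norm_of_one_le hi
  by_cases htype : lform (ltype k) (triEmbed a) = lform (ltype k) (triEmbed b)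
  · -- on the lattice line of the edge: use a varying form
    have hex : ∀ j : Fin 3, ∃ i : Fin 3, i ≠ j := by decide
    obtain ⟨i, hi⟩ := hex (ltype k)
    have hδ := ldelta_eq_one_or_of_ne hi
    obtain ⟨n, hn⟩ := hint i b
    obtain ⟨na, hna⟩ := hint i a
    -- `a` has integer value `na ≠ n, n + δ` (else `a` would be an endpoint, two forms agreeing)
    have hna_ne : na ≠ n := by
      intro h
      apply ha
      apply triEmbed_injective
      exact eq_of_lform_eq hi (by rw [hna, hn, h]) htype
    have hna_ne' : (na : ℝ) ≠ n + ldelta k i := by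
      intro h
      apply ha'
      apply triEmbed_injective
      refine eq_of_lform_eq hi (by rw [hna, lform_triEmbed_add_triDir, hn, h]) ?_
      rw [htype, lform_triEmbed_add_triDir, ldelta_ltype, add_zero]
    refine ⟨i, ?_⟩
    rw [hθ i, hn, hna]
    rcases hδ with hd | hd <;> rw [hd] at hna_ne' ⊢
    · -- values on the edge in `[n, n + 1]`
      have h' : na ≠ n + 1 := fun h => hna_ne' (by rw [h]; push_cast; ring)
      rcases lt_or_gt_of_ne hna_ne with hlt | hgt
      · have : (na : ℝ) + 1 ≤ n := by exact_mod_cast hlt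
        rw [le_abs]; left; nlinarith
      · have : (n : ℝ) + 2 ≤ na := by
          have : n + 2 ≤ na := by omega
          exact_mod_cast this
        rw [le_abs]; right; nlinarith
    · -- values on the edge in `[n - 1, n]`
      have h' : na ≠ n - 1 := fun h => hna_ne' (by rw [h]; push_cast; ring)
      rcases lt_or_gt_of_ne hna_ne with hlt | hgt
      · have : (na : ℝ) + 2 ≤ n := by
          have : na + 2 ≤ n := by omega
          exact_mod_cast this
        rw [le_abs]; left; nlinarith
      · have : (n : ℝ) + 1 ≤ na := by exact_mod_cast hgt
        rw [le_abs]; right; nlinarith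
  · -- off the lattice line: the type form is constant on the edge and differs by `≥ 1`
    refine ⟨ltype k, ?_⟩
    obtain ⟨n, hn⟩ := hint (ltype k) b
    obtain ⟨na, hna⟩ := hint (ltype k) a
    rw [hθ (ltype k), ldelta_ltype, mul_zero, add_zero, hn, hna]
    rw [hn, hna] at htype
    have : na ≠ n := fun h => htype (by rw [h])
    rcases lt_or_gt_of_ne this with hlt | hgt
    · have : (na : ℝ) + 1 ≤ n := by exact_mod_cast hlt
      rw [le_abs]; left; linarith
    · have : (n : ℝ) + 1 ≤ na := by exact_mod_cast hgt
      rw [le_abs]; right; linarith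

end Literature.Probability.Percolation

end
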